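import Summits.CriticalPhenomena.PercolationContinuityZ3.Theorems.FK.OSSSReadoutCube
import HarnessLib

/-!
# The one-arm OSSS variance inequality for the WIRED random-cluster measure of a box, one sphere of seeds
# (Duminil-Copin–Raoufi–Tassion 2019, Lemma 3.2 for `μ_n = φ^w_{Λ_N}`, before the summation over `k`)

Claimed R42 (8)(c) in the cell INBOX at 2026-08-28T02:11:55Z by fkp-10a gen 352 (NEW CLAIM #2 of the gen), addressed to coordinator fk-4 g266 (seated 01:27Z 2026-08-28; R146 l.8252: row FO-10a-g352 = package g352-osss; its (κ) clause sends the FK instantiation to a new claim, R147); lineage row FO-10a-g352f (self-suggested), package g352-fkosss, label FS-D.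
Support file of the `fk-continuity` cell (lineage fkp-10a, `--supports stmt-CriticalPhenomena-4575`); builds on
p205010 (kernel theorem, internal audit signed; external expert review pending).  No definitions, no named facts,
no sorries; standard axioms.  Package `g352-fkosss` = THE FK INSTANTIATION of the OSSS inequality for monotonic measures
(row FO-10a-g352 `g352-osss`): Duminil-Copin–Raoufi–Tassion's Theorem 1.2 (sharpness of the random-cluster phase
transition on `ℤ^d`, `q ≥ 1`) and, on `ℤ²`, `p_c(q) = √q/(1+√q)`.  UNCONDITIONAL; nothing here touches FH / TP_FK / the
`_r3` binders of the cell.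

For `d ≥ 1`, `0 < p < 1`, `q ≥ 1`, `1 ≤ k ≤ n ≤ N`, with `θ = φ¹_{Λ_N,p,q}(0 ↔ ∂Λ_n)` (the lineage's `regionWiredReal` of the
one-arm event `siteToBoundary d n`):

  `θ(1 − θ) ≤ Σ_{e ∈ E(Λ_n)} R_k(e) · Cov_{φ¹_{Λ_N}}(𝟙{0 ↔ ∂Λ_n}, ω_e)`,   `R_k({u,v}) = Σ_{x ∈ {u,v}} φ¹_{Λ_N}(armEvent x |k − ‖x‖_∞|)`

(`wiredBox_oneArm_variance_le`).  Assembly: the generic one-arm OSSS variance inequality for monotonic weights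
(`variance_le_sum_majorant_mul_cov`, `OSSSSeedVariance.lean`, on the OSSS inequality for monotonic measures of `g352-osss`)
applied to the read-out weight `μ(y) = φ¹_{Λ_N}{ω =_{E(Λ_n)} y}` (strictly positive, FKG-lattice, mass one:
`OSSSReadoutCube.lean`) and the lattice incidence of `OSSSLatticeIncidence.lean` (instantiated here by the explicit
`dite` on adjacency), with the sphere `∂Λ_k` as seed set (it separates `0` from `∂Λ_n`); the revealment majorant is the arm
probability `φ¹_{Λ_N}(armEvent u |k − ‖u‖|)` of each endpoint (`sum_mu_seedConn_le`), and the cube sums are read back as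
`φ¹_{Λ_N}`-probabilities by the DICTIONARY proved first (`sum_mu_garm`, `sum_mu_garm_mul_ite`, `sum_mu_ite_apply`,
`sum_mu_seedConn_le`: `Σ μ 𝟙{0 ↔ ∂Λ_n} = φ¹_{Λ_N}(0 ↔ ∂Λ_n)` etc., events agreeing on lattice configurations).  The summation over `k`, the comparison of the arm
probabilities with `θ_j = φ¹_{Λ_{2j}}(0 ↔ ∂Λ_j)` and Russo's formula are the business of the next file.  No definitions.

## References
* H. Duminil-Copin, A. Raoufi, V. Tassion, Ann. of Math. 189 (2019) 75–99, §3 Lemma 3.2 and proof of Thm 1.2.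
  [DuminilCopinRaoufiTassion2019]
* G. Grimmett, *The Random-Cluster Model*, Springer 2006, §4.2 (wired box measures). [Grimmett2006]
-/

noncomputable section

namespace Summit.CriticalPhenomena.PercolationContinuityZ3.Theorems.FK

namespace MonotonicOSSS

open MeasureTheory Finset Function Literature.Probability.ODonnellSaksSchrammServedio2005
open Literature.Probability.Percolation Literature.Probability.LatticeModels
open Literature.Probability.Percolation.GhostExploration Literature.Probability.Percolation.SeedExploration
open Literature.Probability.Percolation.OneArmOSSS Literature.Probability.Percolation.DCT16
open Classical

variable {d n : ℕ}

section Dictionary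

variable {p q : ℝ} {N : ℕ} (μ : (↥(edgesIn (zdGraph d) (box d n)) → Bool) → ℝ)

/-! ### Dictionary: cube sums ↔ events of the lineage -/

variable (edge : BoxV d n → BoxV d n → Option ↥(edgesIn (zdGraph d) (box d n)))

/-- `Σ_y μ(y) 𝟙{0 ↔ ∂Λ_n}(y) = φ¹_{Λ_N}(0 ↔ ∂Λ_n)` (the one-arm event `siteToBoundary`; the two events agree on configurations of
lattice edges). [cite: DuminilCopinRaoufiTassion2019, §3 proof of Thm 1.2 (θ_k = μ_k[0 ↔ ∂Λ_k])] -/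
theorem sum_mu_garm (hedge : ∀ a b e, edge a b = some e ↔ (zdGraph d).Adj a.1 b.1 ∧ (e : Sym2 (Site d)) = s(a.1, b.1))
    (hp : p ∈ Set.Icc (0 : ℝ) 1) (hq : 0 < q)
    (hμ : ∀ y, μ y = regionWiredReal d p q (box d N)
      {ω | ∀ e : ↥(edgesIn (zdGraph d) (box d n)), (e.1 ∈ ω ↔ y e = true)}) :
    ∑ y, μ y * garm edge (origin d n) (bdryTarget d n) y = regionWiredReal d p q (box d N) (siteToBoundary d n) := by
  have h := sum_mu_mul_ite μ hp hq hμ (fun y => Conn edge (origin d n) (bdryTarget d n) y)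
  have hre : ∀ y, μ y * garm edge (origin d n) (bdryTarget d n) y
      = μ y * (if Conn edge (origin d n) (bdryTarget d n) y then 1 else 0) := fun y => by
    unfold garm; congr 1
  rw [Finset.sum_congr rfl fun y _ => hre y, h]
  refine regionWiredReal_congr_lattice d hp hq _ fun ω hω => ?_
  exact ⟨fun h => mem_siteToBoundary_of_conn' edge hedge h, fun h => conn_of_mem_siteToBoundary' edge hedge hω h⟩

/-- `Σ_y μ(y) 𝟙{0 ↔ ∂Λ_n}(y) 𝟙{y_e} = φ¹_{Λ_N}(0 ↔ ∂Λ_n, e open)`. [cite: DuminilCopinRaoufiTassion2019, §3 Lemma 3.2 (Cov(𝟙_{0↔∂Λ_n}, ω_e))] -/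
theorem sum_mu_garm_mul_ite (hedge : ∀ a b e, edge a b = some e ↔ (zdGraph d).Adj a.1 b.1 ∧ (e : Sym2 (Site d)) = s(a.1, b.1))
    (hp : p ∈ Set.Icc (0 : ℝ) 1) (hq : 0 < q)
    (hμ : ∀ y, μ y = regionWiredReal d p q (box d N)
      {ω | ∀ e : ↥(edgesIn (zdGraph d) (box d n)), (e.1 ∈ ω ↔ y e = true)})
    (e : ↥(edgesIn (zdGraph d) (box d n))) :
    ∑ y, μ y * (garm edge (origin d n) (bdryTarget d n) y * if y e = true then 1 else 0)
      = regionWiredReal d p q (box d N) (siteToBoundary d n ∩ {ω | e.1 ∈ ω}) := by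
  have h := sum_mu_mul_ite μ hp hq hμ (fun y => Conn edge (origin d n) (bdryTarget d n) y ∧ y e = true)
  have hre : ∀ y, μ y * (garm edge (origin d n) (bdryTarget d n) y * if y e = true then 1 else 0)
      = μ y * (if (Conn edge (origin d n) (bdryTarget d n) y ∧ y e = true) then 1 else 0) := fun y => by
    unfold garm
    by_cases h1 : Conn edge (origin d n) (bdryTarget d n) y <;> by_cases h2 : y e = true <;> simp [h1, h2]
  rw [Finset.sum_congr rfl fun y _ => hre y, h]
  refine regionWiredReal_congr_lattice d hp hq _ fun ω hω => ?_
  simp only [Set.mem_setOf_eq, decide_eq_true_eq, Set.mem_inter_iff]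
  exact ⟨fun h => ⟨mem_siteToBoundary_of_conn' edge hedge h.1, h.2⟩,
    fun h => ⟨conn_of_mem_siteToBoundary' edge hedge hω h.1, h.2⟩⟩

/-- `Σ_y μ(y) 𝟙{y_e} = φ¹_{Λ_N}(e open)`. [cite: DuminilCopinRaoufiTassion2019, §3 Lemma 3.2 (the variable ω_e)] -/
theorem sum_mu_ite_apply (hp : p ∈ Set.Icc (0 : ℝ) 1) (hq : 0 < q)
    (hμ : ∀ y, μ y = regionWiredReal d p q (box d N)
      {ω | ∀ e : ↥(edgesIn (zdGraph d) (box d n)), (e.1 ∈ ω ↔ y e = true)})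
    (e : ↥(edgesIn (zdGraph d) (box d n))) :
    ∑ y, μ y * (if y e = true then 1 else 0) = regionWiredReal d p q (box d N) {ω | e.1 ∈ ω} := by
  rw [sum_mu_mul_ite μ hp hq hμ (fun y => y e = true)]
  congr 1
  ext ω
  simp only [Set.mem_setOf_eq, decide_eq_true_eq]

/-- REVEALMENT PROBABILITIES ARE ARM PROBABILITIES: `Σ_y μ(y) 𝟙{a ↔ ∂Λ_k in Λ_n}(y) ≤ φ¹_{Λ_N}(armEvent a |k − ‖a‖|)` (`d ≥ 1`).
[cite: DuminilCopinRaoufiTassion2019, §3 proof of Lemma 3.2 (μ[u ↔ ∂Λ_k] ≤ μ[u ↔ ∂Λ_{|k−d(u,0)|}(u)])] -/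
theorem sum_mu_seedConn_le (hedge : ∀ a b e, edge a b = some e ↔ (zdGraph d).Adj a.1 b.1 ∧ (e : Sym2 (Site d)) = s(a.1, b.1))
    (hd : 1 ≤ d) (hp : p ∈ Set.Icc (0 : ℝ) 1) (hq : 0 < q)
    (hμ : ∀ y, μ y = regionWiredReal d p q (box d N)
      {ω | ∀ e : ↥(edgesIn (zdGraph d) (box d n)), (e.1 ∈ ω ↔ y e = true)})
    (k : ℕ) (a : BoxV d n) :
    ∑ y, μ y * (if SeedConn edge (sphereSeed d n k) y a then 1 else 0)
      ≤ regionWiredReal d p q (box d N) (armEvent a.1 (Nat.dist k (boxNorm a.1))) := by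
  rw [sum_mu_mul_ite μ hp hq hμ (fun y => SeedConn edge (sphereSeed d n k) y a),
    regionWiredReal_congr_lattice d hp hq (box d N)
      (A' := {ω | SeedConn edge (sphereSeed d n k) (fun e : ↥(edgesIn (zdGraph d) (box d n)) => decide (e.1 ∈ ω)) a}
        ∩ {ω | ω ⊆ (zdGraph d).edgeSet})
      (fun ω hω => by simp only [Set.mem_setOf_eq, Set.mem_inter_iff, hω, and_true])]
  refine regionWiredReal_mono_set d hp hq _ fun ω hω => ?_
  exact armEvent_of_seedConn' edge hedge hd hω.2 hω.1

end Dictionary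

/-- Every lattice edge of `Λ_n` has two adjacent endpoints in `Λ_n`. [cite: DuminilCopinRaoufiTassion2019, §3 Lemma 3.2 (edges e = uv)] -/
theorem exists_ends (e : ↥(edgesIn (zdGraph d) (box d n))) :
    ∃ a b : BoxV d n, (zdGraph d).Adj a.1 b.1 ∧ (e : Sym2 (Site d)) = s(a.1, b.1) := by
  obtain ⟨z, hz⟩ := e
  revert hz
  refine Sym2.ind (fun u v => ?_) z
  intro hz
  have hz' := hz
  rw [mem_edgesIn_iff] at hz'
  obtain ⟨hadj, hmem⟩ := hz'
  exact ⟨⟨u, hmem u (Sym2.mem_mk_left u v)⟩, ⟨v, hmem v (Sym2.mem_mk_right u v)⟩,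
    (SimpleGraph.mem_edgeSet _).1 hadj, rfl⟩

/-- A sum over the sites of `Λ_n` lying on the edge `{u,v}` is the sum over its two endpoints. [folklore] -/
theorem sum_filter_mem_mk {u v : Site d} (huv : u ≠ v) (hu : u ∈ box d n) (hv : v ∈ box d n) (f : Site d → ℝ) :
    ∑ x ∈ (box d n).filter (fun x => x ∈ s(u, v)), f x = f u + f v := by
  have hset : (box d n).filter (fun x => x ∈ s(u, v)) = {u, v} := by
    ext x
    simp only [Finset.mem_filter, Sym2.mem_iff, Finset.mem_insert, Finset.mem_singleton]
    constructor
    · rintro ⟨_, h⟩; exact h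
    · rintro (rfl | rfl)
      · exact ⟨hu, Or.inl rfl⟩
      · exact ⟨hv, Or.inr rfl⟩
  rw [hset, Finset.sum_pair huv]

/-- THE EXPLICIT LATTICE INCIDENCE `edge a b = if a ∼ b then some {a,b} else none` satisfies the pinning characterisation of
`OSSSLatticeIncidence.lean`. [cite: DuminilCopinRaoufiTassion2019, §3 Lemma 3.2 (the graph (Λ_n, E))] -/
theorem dite_edge_spec (a b : BoxV d n) (e : ↥(edgesIn (zdGraph d) (box d n))) :
    (if h : (zdGraph d).Adj a.1 b.1 then some (⟨s(a.1, b.1), mk_mem_edgesIn_box h⟩ : ↥(edgesIn (zdGraph d) (box d n)))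
      else none) = some e ↔ (zdGraph d).Adj a.1 b.1 ∧ (e : Sym2 (Site d)) = s(a.1, b.1) := by
  by_cases h : (zdGraph d).Adj a.1 b.1
  · rw [dif_pos h]
    constructor
    · intro he
      have := Option.some.inj he
      exact ⟨h, by rw [← this]⟩
    · rintro ⟨_, he⟩
      congr 1
      exact Subtype.ext he.symm
  · rw [dif_neg h]
    exact ⟨fun h' => (by cases h'), fun h' => absurd h'.1 h⟩

/-- **THE ONE-ARM OSSS VARIANCE INEQUALITY FOR THE WIRED BOX MEASURE, ONE SPHERE OF SEEDS** (`d ≥ 1`, `0 < p < 1`,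
`q ≥ 1`, `1 ≤ k ≤ n ≤ N`): with `θ = φ¹_{Λ_N,p,q}(0 ↔ ∂Λ_n)`,
`θ(1 − θ) ≤ Σ_{e ∈ E(Λ_n)} (Σ_{x ∈ e} φ¹_{Λ_N}(armEvent x |k − ‖x‖|)) · (φ¹_{Λ_N}(0 ↔ ∂Λ_n, e open) − θ·φ¹_{Λ_N}(e open))`.
[cite: DuminilCopinRaoufiTassion2019, §3 Lemma 3.2 (applied to μ_n = φ^w_{Λ_{2n}}, one k) and eq. (3.?) δ_e(T) ≤ μ[u↔∂Λ_k] + μ[v↔∂Λ_k]] -/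
theorem wiredBox_oneArm_variance_le (hd : 1 ≤ d) {p q : ℝ} (hp : p ∈ Set.Ioo (0 : ℝ) 1) (hq : 1 ≤ q) {k N : ℕ}
    (hk1 : 1 ≤ k) (hkn : k ≤ n) (hnN : n ≤ N) :
    regionWiredReal d p q (box d N) (siteToBoundary d n) * (1 - regionWiredReal d p q (box d N) (siteToBoundary d n))
      ≤ ∑ e : ↥(edgesIn (zdGraph d) (box d n)),
        (∑ x ∈ (box d n).filter (fun x => x ∈ (e : Sym2 (Site d))),
            regionWiredReal d p q (box d N) (armEvent x (Nat.dist k (boxNorm x))))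
        * (regionWiredReal d p q (box d N) (siteToBoundary d n ∩ {ω | e.1 ∈ ω})
          - regionWiredReal d p q (box d N) (siteToBoundary d n) * regionWiredReal d p q (box d N) {ω | e.1 ∈ ω}) := by
  have hpI : p ∈ Set.Icc (0 : ℝ) 1 := ⟨hp.1.le, hp.2.le⟩
  have hq0 : 0 < q := one_pos.trans_le hq
  -- the incidence and the read-out weight
  set edge : BoxV d n → BoxV d n → Option ↥(edgesIn (zdGraph d) (box d n)) := fun a b =>
    if h : (zdGraph d).Adj a.1 b.1 then some ⟨s(a.1, b.1), mk_mem_edgesIn_box h⟩ else none with hedge_def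
  have hedge : ∀ a b e, edge a b = some e ↔ (zdGraph d).Adj a.1 b.1 ∧ (e : Sym2 (Site d)) = s(a.1, b.1) :=
    fun a b e => dite_edge_spec a b e
  set μ : (↥(edgesIn (zdGraph d) (box d n)) → Bool) → ℝ := fun y => regionWiredReal d p q (box d N)
    {ω | ∀ e : ↥(edgesIn (zdGraph d) (box d n)), (e.1 ∈ ω ↔ y e = true)} with hμ_def
  have hμ : ∀ y, μ y = regionWiredReal d p q (box d N)
      {ω | ∀ e : ↥(edgesIn (zdGraph d) (box d n)), (e.1 ∈ ω ↔ y e = true)} := fun _ => rfl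
  have key := variance_le_sum_majorant_mul_cov (edge_symm' edge hedge) μ (mu_pos μ hp hq0 hnN hμ)
    (mu_lattice μ hpI hq hμ) (sum_mu_eq_one μ hpI hq0 hμ) (separates_sphereSeed' edge hedge hk1 hkn)
    (fun e => ∑ x ∈ (box d n).filter (fun x => x ∈ (e : Sym2 (Site d))),
      regionWiredReal d p q (box d N) (armEvent x (Nat.dist k (boxNorm x)))) (fun e => by
      obtain ⟨a, b, hadj, he⟩ := exists_ends e
      refine ⟨a, b, fun a' b' h' => edge_ends' edge hedge e a b a' b' ((hedge a b e).2 ⟨hadj, he⟩) h', ?_⟩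
      rw [he, sum_filter_mem_mk hadj.ne a.2 b.2]
      exact add_le_add (sum_mu_seedConn_le μ edge hedge hd hpI hq0 hμ k a)
        (sum_mu_seedConn_le μ edge hedge hd hpI hq0 hμ k b))
  simp only [sum_mu_garm μ edge hedge hpI hq0 hμ, sum_mu_garm_mul_ite μ edge hedge hpI hq0 hμ,
    sum_mu_ite_apply μ hpI hq0 hμ] at key
  exact key

/-- **FKG for the two events**: `φ¹_{Λ_N}(0 ↔ ∂Λ_n, e open) − φ¹_{Λ_N}(0 ↔ ∂Λ_n)·φ¹_{Λ_N}(e open) ≥ 0` for an edge `e` of `Λ_n`,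
`n ≤ N` (positive association of the read-out weight, Mathlib `fkg` on its FKG lattice condition).
[cite: Grimmett2006, Thm (3.8)(b) (positive association of φ_{p,q}, q ≥ 1)] -/
theorem wiredBox_cov_nonneg {p q : ℝ} (hp : p ∈ Set.Ioo (0 : ℝ) 1) (hq : 1 ≤ q) {N : ℕ} (hnN : n ≤ N)
    (e : ↥(edgesIn (zdGraph d) (box d n))) :
    0 ≤ regionWiredReal d p q (box d N) (siteToBoundary d n ∩ {ω | e.1 ∈ ω})
      - regionWiredReal d p q (box d N) (siteToBoundary d n) * regionWiredReal d p q (box d N) {ω | e.1 ∈ ω} := by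
  have hpI : p ∈ Set.Icc (0 : ℝ) 1 := ⟨hp.1.le, hp.2.le⟩
  have hq0 : 0 < q := one_pos.trans_le hq
  set edge : BoxV d n → BoxV d n → Option ↥(edgesIn (zdGraph d) (box d n)) := fun a b =>
    if h : (zdGraph d).Adj a.1 b.1 then some ⟨s(a.1, b.1), mk_mem_edgesIn_box h⟩ else none with hedge_def
  have hedge : ∀ a b e, edge a b = some e ↔ (zdGraph d).Adj a.1 b.1 ∧ (e : Sym2 (Site d)) = s(a.1, b.1) :=
    fun a b e => dite_edge_spec a b e
  set μ : (↥(edgesIn (zdGraph d) (box d n)) → Bool) → ℝ := fun y => regionWiredReal d p q (box d N)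
    {ω | ∀ e : ↥(edgesIn (zdGraph d) (box d n)), (e.1 ∈ ω ↔ y e = true)} with hμ_def
  have hμ : ∀ y, μ y = regionWiredReal d p q (box d N)
      {ω | ∀ e : ↥(edgesIn (zdGraph d) (box d n)), (e.1 ∈ ω ↔ y e = true)} := fun _ => rfl
  have h := fkg (garm edge (origin d n) (bdryTarget d n)) (fun y => if y e = true then (1 : ℝ) else 0) μ
    (fun y => (mu_pos μ hp hq0 hnN hμ y).le) (fun y => (garm_mem_unit _ _ y).1) (fun y => by positivity)
    (garm_monotone _ _) (monotone_ite_apply e) (mu_lattice μ hpI hq hμ)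
  rw [sum_mu_eq_one μ hpI hq0 hμ, one_mul, sum_mu_garm μ edge hedge hpI hq0 hμ, sum_mu_ite_apply μ hpI hq0 hμ,
    sum_mu_garm_mul_ite μ edge hedge hpI hq0 hμ] at h
  exact sub_nonneg.2 h

end MonotonicOSSS

end Summit.CriticalPhenomena.PercolationContinuityZ3.Theorems.FK
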